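import Summits.BirchSwinnertonDyer.Rank1Residual.Additive.RamifiedSevenGenusChiLogarithmCalculus
import Literature.NumberTheory.IwasawaTheory.IwasawaAlgebraArtinElementFamily
import Mathlib.NumberTheory.NumberField.Units.Basic
import Mathlib.RingTheory.Norm.Transitivity
import HarnessLib

set_option autoImplicit false

/-!
# `𝒞₇` genus road (crux `EllipticUnitValueSevenOfGZK`, K7r), the (5)-unit programme (SUMMON GENUS-UNIT-A5), File C2b-α:
# (ii) THE TRIVIAL CHARACTER SEES NO UNIT (`Σ_g log‖Φ(g u)‖ = log|N_{L/ℚ}(u)| = 0`), and E0: THE Λ-ADIC UNIT `W(b)`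
# EXISTS ON EVERY VALUE-PINNED FAMILY (★★★′ ∘ torsor compatibility ∘ File D) — THEOREMS ONLY

Cell bsd-cm, seat bsd-cm-k-ty1 g26 (literature-prover); ruled memo `pub/bsd-cm/bsd-cm-k-ty1/g26/G45-typing-memo.md` S7 (ii) /
S8 (iv) (c225f82434dc25c5; pen D963/D965).  Two successor inputs:

* §1 `logSum_trivial_eq_zero`, `logSum_one_character_eq_zero` — for `u ∈ L` with `u` and `u⁻¹` algebraic integers (a unit of
  `𝓞 L`), `Σ_{g ∈ Gal(L/ℚ)} log‖Φ(g u)‖ = 0`: the product of the conjugates is `N_{L/ℚ}(u) = ±1` (Mathlib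
  `Algebra.norm_eq_prod_automorphisms`, `NumberField.isUnit_iff_norm`).  This disposes of `χ = 1` in S7 (D963 (ii)).
* §2 ★ `exists_artinUnit_of_isNormedEllipticUnitFamily` — for `IsNormedEllipticUnitFamily F θu`, a Sinnott family `ξ`, and
  ANY `c ∈ ℤ₇ˣ`: ONE complex embedding `Φ`, ONE torsor system `b` (`Φ(ζsys n) = e^{2πi b n/mₙ}`), and a UNIT `W ∈ Λˣ` with
  `W ≡ C c·(1+T)^{r_j(b_j)} (mod h_j)` for every `j` (File D on the compatible family `(b j).val`, C2a §4), TOGETHER WITH the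
  master identity of ★★★′ at every level — the witness pipeline of the `∃ u : Λˣ` of `UnitSideIdentityShapeUpToUnit`
  (memo S8 (iv): the successor instantiates `c := η₁(b₀)`).

HONEST LABEL: conditional on F5 (§2); no definition, no named fact, no instance; nothing closes; stmt-BirchSwinnertonDyer-19945
OPEN; K1ᵘ NOT proved (C2b's character computation and File E ahead); no summit statement is proved by this seat.

## References
* L. C. Washington, *Introduction to Cyclotomic Fields* (1997) §8.3, §7.2 Thm 7.10 [Washington1997]; S. Lang, *Cyclotomic Fields
  I–II* (1990) Ch. 5 §1 Thm 1.1, Ch. 10 §1 [Lang1990]; K. Kato, Astérisque 295 (2004) §15.5 (15.5.1) [Kato2004Asterisque];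
  T. Tsuji, J. Number Theory 78 (1999) §6 [Tsuji1999].
* Tree: B3b (p789711), C2a, File D (p789769) (this seat).
-/

noncomputable section

open scoped NumberField ComplexConjugate
open Field PowerSeries
open Literature.NumberTheory.IwasawaTheory.StickelbergerSeries (layerModulus)
open Literature.NumberTheory.IwasawaTheory.CyclotomicUnits (sinnottNorm)
open Literature.NumberTheory.QuadraticFields (jacobiChar)
open Literature.NumberTheory.EllipticCurves (IwasawaAlgebra)
open Literature.NumberTheory.ComplexMultiplication.EllipticUnits

namespace Summit.BirchSwinnertonDyer.Rank1Residual.Additive.GenusSeven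

/-! ## §1 The trivial character sees no unit -/

section TrivialCharacter

/-- **`Σ_{g ∈ Gal(L/ℚ)} log‖Φ(g u)‖ = 0` for a unit `u` of `𝓞 L`** (`u`, `u⁻¹` algebraic integers): the conjugates multiply to
`N_{L/ℚ}(u) = ±1`. [cite: Washington1997, §8.3] -/
theorem logSum_trivial_eq_zero (L : IntermediateField ℚ (AlgebraicClosure ℚ)) [Normal ℚ L] [FiniteDimensional ℚ L]
    (Φ : AlgebraicClosure ℚ →+* ℂ) {u : L} (hu : IsIntegral ℤ u) (hu' : IsIntegral ℤ u⁻¹) :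
    ∑ᶠ g : L ≃ₐ[ℚ] L, (Real.log ‖Φ (((g u : L)) : AlgebraicClosure ℚ)‖ : ℂ) = 0 := by
  classical
  by_cases h0 : u = 0
  · refine finsum_eq_zero_of_forall_eq_zero fun g => ?_
    rw [h0, map_zero, ZeroMemClass.coe_zero, map_zero, norm_zero, Real.log_zero, Complex.ofReal_zero]
  haveI : NumberField L := { to_charZero := inferInstance, to_finiteDimensional := inferInstance }
  haveI : IsGalois ℚ L := IsGalois.mk
  -- `u` as a unit of `𝓞 L`, of norm `±1`
  let x : 𝓞 L := ⟨u, hu⟩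
  have hxu : IsUnit x := by
    refine isUnit_iff_exists_inv.mpr ⟨⟨u⁻¹, hu'⟩, ?_⟩
    apply Subtype.ext
    show u * u⁻¹ = 1
    exact mul_inv_cancel₀ h0
  have hnorm : |(RingOfIntegers.norm ℚ x : ℚ)| = 1 := NumberField.isUnit_iff_norm.mp hxu
  have hnorm' : (RingOfIntegers.norm ℚ x : ℚ) = Algebra.norm ℚ u := RingOfIntegers.coe_norm ℚ x
  -- the product of the conjugates
  have hprod : ∏ g : L ≃ₐ[ℚ] L, Φ (((g u : L)) : AlgebraicClosure ℚ) = ((Algebra.norm ℚ u : ℚ) : ℂ) := by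
    rw [← map_prod Φ, ← SubmonoidClass.coe_finsetProd, ← Algebra.norm_eq_prod_automorphisms ℚ u, eq_ratCast]
    simp [map_ratCast]
  have hne : ∀ g : L ≃ₐ[ℚ] L, ‖Φ (((g u : L)) : AlgebraicClosure ℚ)‖ ≠ 0 := fun g => by
    rw [norm_ne_zero_iff, map_ne_zero]; exact_mod_cast (map_ne_zero g).mpr h0
  have hn1 : |((Algebra.norm ℚ u : ℚ) : ℝ)| = 1 := by rw [← hnorm', ← Rat.cast_abs, hnorm, Rat.cast_one]
  rw [finsum_eq_sum_of_fintype, ← Complex.ofReal_sum, ← Real.log_prod (s := Finset.univ) (fun g _ => hne g), ← norm_prod, hprod,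
    Complex.norm_ratCast, hn1, Real.log_one, Complex.ofReal_zero]

/-- The same in the B-files' currency at `χ = 1`: `Σ_g 1(g)·log‖Φ(g u)‖ = 0` — S7's bookkeeping for the trivial character
(D963 (ii)). [cite: Washington1997, §8.3] -/
theorem logSum_one_character_eq_zero (L : IntermediateField ℚ (AlgebraicClosure ℚ)) [Normal ℚ L] [FiniteDimensional ℚ L]
    (Φ : AlgebraicClosure ℚ →+* ℂ) {u : L} (hu : IsIntegral ℤ u) (hu' : IsIntegral ℤ u⁻¹) :
    ∑ᶠ g : L ≃ₐ[ℚ] L, (((1 : (L ≃ₐ[ℚ] L) →* ℂˣ) g : ℂˣ) : ℂ) *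
      (Real.log ‖Φ (((g u : L)) : AlgebraicClosure ℚ)‖ : ℂ) = 0 := by
  simp only [MonoidHom.one_apply, Units.val_one, one_mul]
  exact logSum_trivial_eq_zero L Φ hu hu'

/-- A global unit of `F′ₙ` read in `F′ₙ` (`toFieldUnits`) has integral inverse — the form §1 consumes for `θu n`.
[cite: Washington1997, §8.3] -/
theorem isIntegral_toFieldUnits_inv {K : Type} [Field K] [NumberField K] (E : IntermediateField K (AlgebraicClosure K))
    (u : globalUnitsOf E) : IsIntegral ℤ (((toFieldUnits E u : (E : Type)ˣ) : E))⁻¹ := by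
  rw [← Units.val_inv_eq_inv_val, ← map_inv]
  exact isIntegral_toFieldUnits E u⁻¹

end TrivialCharacter

/-! ## §2 E0: the `Λ`-adic unit `W(b)` exists on every value-pinned family -/

section ArtinUnit

/-- ★ **`W(b)` EXISTS ON THE PIN, together with the master identity**: for `IsNormedEllipticUnitFamily F θu`, a family
`ξ n = sinnottNorm F′ₙ (ζsys n) 1`, and any `c ∈ ℤ₇ˣ`, there are ONE complex embedding `Φ`, ONE torsor system `b` and a
UNIT `W ∈ Λˣ` with `Φ(ζsys n) = e^{2πi b n/mₙ}` (all `n`), `W ≡ C c·(1+T)^{r_j((b j).val)} (mod h_j)` (all `j`; `r = F.r`,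
the frame's `γ`-log table of `u`), and the master identity ★★★′ at every level for every even reading `(χ, ψ)`.
CONDITIONAL on F5 only. [cite: Kato2004Asterisque, §15.5 (15.5.1) (p. 253)] [cite: Lang1990, Ch. 5 §1 Thm. 1.1 and Ch. 10 §1 (PDF pp. 115–116, 167)]
[cite: Washington1997, §7.2 Thm 7.10] -/
theorem exists_artinUnit_of_isNormedEllipticUnitFamily (hF5 : Kato2004.kato1551_kroneckerLimitFormula) (F : GenusFrame)
    {θu : ∀ n : ℕ, globalUnitsOf (F.layer n)} (hθu : IsNormedEllipticUnitFamily F θu)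
    (ξ : ∀ n : ℕ, F.layer n)
    (hξ : ∀ n : ℕ, ((ξ n : F.layer n) : AlgebraicClosure ℚ) = sinnottNorm (t := 7 ^ (n + 1) * F.d) (F.layer n) (F.ζsys n) 1)
    (c : ℤ_[7]ˣ) :
    ∃ (Φ : AlgebraicClosure ℚ →+* ℂ) (b : ∀ n : ℕ, (ZMod (7 ^ (n + 1) * F.d))ˣ) (W : (IwasawaAlgebra 7)ˣ),
      (∀ n : ℕ, Φ (F.ζsys n) =
        Complex.exp (2 * Real.pi * Complex.I / (7 ^ (n + 1) * F.d : ℕ)) ^ ((b n : ZMod (7 ^ (n + 1) * F.d))).val) ∧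
      (∀ j : ℕ, (W : IwasawaAlgebra 7) - C (c : ℤ_[7]) * (1 + X) ^ (F.r j ((b j : ZMod (7 ^ (j + 1) * F.d))).val) ∈
        Ideal.span {layerModulus 7 j}) ∧
      ∀ (n : ℕ) (ψ : DirichletCharacter ℂ (7 ^ (n + 1) * F.d)), ψ.Even → ψ ≠ 1 →
        ∀ {M : ℕ} [NeZero M] (Ψ : DirichletCharacter ℂ M), (∀ k : ℕ, Ψ k = ψ k * jacobiChar 7 k) → Ψ.Odd →
        ∀ (χ : (F.layer n ≃ₐ[ℚ] F.layer n) →* ℂˣ),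
          (∀ (σ : AlgebraicClosure ℚ ≃ₐ[ℚ] AlgebraicClosure ℚ) (g : F.layer n ≃ₐ[ℚ] F.layer n) (a : ℕ),
            (∀ y : F.layer n, ((g y : F.layer n) : AlgebraicClosure ℚ) = σ y) → σ (F.ζsys n) = F.ζsys n ^ a → χ g = ψ a) →
          ∑ᶠ g : F.layer n ≃ₐ[ℚ] F.layer n, ((χ g : ℂˣ) : ℂ) *
              (Real.log ‖Φ ((g ((toFieldUnits (F.layer n) (θu n) : (F.layer n : Type)ˣ) : F.layer n) : F.layer n) :
                AlgebraicClosure ℚ)‖ : ℂ) =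
            -(1 / 2) * ((F.normA : ℂ) - (ψ F.normA)⁻¹) * ((∑ a : ZMod M, (a.val : ℂ) * Ψ a) / M) * ψ (b n) *
              ∑ᶠ g : F.layer n ≃ₐ[ℚ] F.layer n, ((χ g : ℂˣ) : ℂ) *
                (Real.log ‖Φ ((g (ξ n) : F.layer n) : AlgebraicClosure ℚ)‖ : ℂ) := by
  obtain ⟨Φ, b, hb, hmaster⟩ := exists_masterIdentity_of_isNormedEllipticUnitFamily hF5 F hθu ξ hξ
  obtain ⟨W, hW⟩ := F.r_logTable.exists_artinElementFamily (by decide) F.u_topGenerator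
    (b := fun j => ((b j : ZMod (7 ^ (j + 1) * F.d))).val) (fun j => F.torsor_val_coprime j (b j))
    (fun j => F.torsor_val_modEq_pow hb j) (c : ℤ_[7])
  have hWu : IsUnit W := Literature.NumberTheory.IwasawaTheory.isUnit_of_artinElementFamily (hW 0) (Units.isUnit c)
  refine ⟨Φ, b, hWu.unit, hb, fun j => ?_, hmaster⟩
  rw [IsUnit.unit_spec]
  exact hW j

end ArtinUnit

end Summit.BirchSwinnertonDyer.Rank1Residual.Additive.GenusSeven

end
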